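/-
Copyright (c) 2026 the pub-hodgecm-mathlib formalisation cell (harness21).  Prover seat hodgecm-mathlib-K2E3-p14 (g8), Track B «K2-LIT» ∕ h413
(`stmt-HodgeConjecture-24833`), line `K2_E3_EllipticInputs`, PART «RANK» (qs2-ps) «van Dijk₂» (cut K2E3-p21 (g7)), brick D118 (WEYL₂), stage W2-2 «KIT₂»:
the `N = 2` glue of the Weyl-integration chain on `U(1,1) = U(Φ₂)(L⁺_v)` — the ports, token for token, of ★ `F0P3cStCharTSWeylHypWIF` §2∕§3, ★ `F0P3cStCharTSWeylHypWIFJac`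
§1 and ★ `F0P3cStCharTSTorusChartIso` §3 to the carrier of ★ D115 `K2E3QuasiSplitTwoTorusDefs`.  2026-09-04.
-/
import Summits.HodgeConjecture.HodgeConjecture.Theorems.K2E3QuasiSplitTwoWeylRadial      -- ★ p860713 W2-1 (this lineage): `isClosed_cmBorelTriple_M_two`, `exists_mem_torusU_isRegularElt_two_cm`, the radial formula; brings ★ WeylHypMeasure ∕ Torsor ∕ Fibre ∕ CM, ★ JAC-LOC₂ (B4) `F0P3cStCharTSUpTrU2Norm`
import Summits.HodgeConjecture.HodgeConjecture.Theorems.K2E3QuasiSplitTwoTorusDefs       -- ★ p860691 D115 (K2E3-p26 (g0)): `torusChart₂`, `torusChartEquiv₂`, `hyperbolicSet₂`, `dgFormula₂`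
import Summits.HodgeConjecture.HodgeConjecture.Theorems.F0P3cStCharTSWeylHypWIF           -- ★ p849936 (LH2-p02 (g3)): generic §1 `orbitalIntegral_eq_integral_conjFamily_of_centralizer_eq`; brings ★ `OrbitalMeasureCanonicalAtPoint` ∕ `…ExistsCM`, ★ `isUnit_antidiagOne_det`, ★ `antidiagOne_map_transpose`
import Literature.NumberTheory.Automorphic.CMTorusRegularAEPairwise                          -- ★ `ae_isUnit_torusEntry_sub_two` (regular torus elements have full Haar measure, `N = 2`)
import Literature.MeasureTheory.Group.InvariantQuotientNormalized                            -- ★ `isInvInvariant_map_mulEquiv`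
import HarnessLib

/-!
# K2_E3 road (h413), PART «RANK» (qs2-ps), brick (WEYL₂) W2-2 «KIT₂» — the `N = 2` glue of the Weyl integration formula on the hyperbolic set of `U(1,1)`

Cell `pub/hodgecm-mathlib` (D-0151), Track B, seat K2E3-p14 (g8); dealer K2E3-plan (g4) D118 (2026-09-04T13:33:49Z; (6a) 13:52:08Z → lineage g8); consumer (ASM₂) =
K2E3-p21 (g8) `charLocIntNear_of_bricks (hVDW) (hWEYL) (hHCD) (hCLS)`.  `--supports stmt-HodgeConjecture-24833 --as helper`; THEOREMS ONLY (no `def`, no instance, no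
notation, no named fact, no `sorry`); ★-only imports; never imports `Cruxes/…/Lines`.  COUNT-NEUTRAL.

CURRENCY (★ D115).  `G₂ = ↥(unitaryGroupOfForm (conjLocal L c v) (cmLocalForm L 2 v))` (`= U(Φ₂)(L⁺_v) = U(1,1)` at a non-split `v`), `T₂ = (cmBorelTriple L 2 v).M`
(`= torusU`, definitionally) its diagonal torus, PARAMETER torus `M₂ = (LocalRing L v)ˣ` (`= E_wˣ`), chart `ι₂ = torusChart₂ L v : M₂ → T₂` (★ `torusChartEquiv₂`, a
topological group isomorphism), `Ω₂ = hyperbolicSet₂ L v`, `T₂ᶜ = compactCore T₂`, `O^{can}_t(φ) = classOrbitalIntegral mQv φ ⟦t⟧` for a CANONICAL family `mQv` (★ `IsCanonical`).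
WHAT THIS FILE ADDS — every `N = 3` glue lemma the density Weyl formula (W2-3, next file) and the (ASM₂) assembly read, at `N = 2`:
* §1 **`hyperbolicSet₂_eq_hypSet`** (★ D115's `Ω₂` IS the set `Ω` of ★ W2-1), **`measurableSet_hypSet₂`** ∕ **`measurableSet_hyperbolicSet₂`** (`Ω₂` is Borel: Lusin–Souslin, the
  block of ★ W2-1 §2 exported), `setOf_coe_mem_hypSet₂_eq` (`T₂ ∩ Ω₂ = T₂^{reg}`);
* §2 **`isCompact_isOpen_compactCore_cmTorus₂`**, **`ae_isRegularElt_cmTorus₂`** (`tT`-a.e. `t ∈ T₂` is regular, every Haar `tT`; ★ `ae_isUnit_torusEntry_sub_two`),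
  **`exists_haar_cmTorus_compactCore_eq_one₂`** (a Haar measure on `T₂`, inversion invariant, mass one on `T₂ᶜ`);
* §3 **`isHaarMeasure_map_torusChart₂`**, **`isInvInvariant_map_torusChart₂`**, **`integral_comp_torusChart₂`**, **`lintegral_comp_torusChart₂`**,
  **`measurableEmbedding_torusChart₂`** (Haar transport ∕ change of variables along `ι₂`);
* §4 **`classOrbitalIntegral_mk_eq_integral_conjFamily₂`** — for `mQv` canonical, `tT` THE Haar measure of `T₂` with `tT(T₂ᶜ) = 1`, `t ∈ T₂^{reg}`, `φ` measurable:
  `classOrbitalIntegral mQv φ ⟦t⟧ = ∫_{G₂ ⧸ T₂} φ(Φ(q, t)) d(ν∕tT)(q)` (★ `IsCanonical.classOrbitalIntegral_mk_eq_orbitalIntegral'` + ★ WIF §1, `Z(t) = T₂` by ★ (A1)).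
[Rogawski1990, §12.5 p. 182; §4.3 (4.3.1) p. 43; §12.2 p. 173] [HarishChandra1970, Lemma 42] [DeitmarEchterhoff2014, Thm. 1.5.3]
HONEST LABEL: HC_CM is proved only modulo the 7 printed citations (2 remaining named inputs: hLiu418 = stmt-HodgeConjecture-24832, h413 = stmt-HodgeConjecture-24833)
until rung 0 closes; count-neutral helper of the (WEYL₂) line.

## References
* [Rogawski1990] J. D. Rogawski, *Automorphic Representations of Unitary Groups in Three Variables*, Ann. of Math. Stud. 123 (1990), §12.5 p. 182; §4.3 (4.3.1) p. 43;
  §4.9 p. 54; §12.2 p. 173; §12.7 L. 12.7.2 (proof) p. 193; §1.10 p. 9.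
* [HarishChandra1970] Harish-Chandra (notes by G. van Dijk), *Harmonic Analysis on Reductive p-adic Groups*, LNM 162 (1970), Lemma 42 (and Lemma 22).
* [DeitmarEchterhoff2014] A. Deitmar, S. Echterhoff, *Principles of Harmonic Analysis*, 2nd ed. (2014), Thm. 1.5.3.
* [vanDijk1972] G. van Dijk, *Computation of certain induced characters of p-adic groups*, Math. Ann. 199 (1972), §2.
-/

set_option autoImplicit false
set_option linter.dupNamespace false

noncomputable section

open MeasureTheory Measure Set Filter Topology Function NumberField IsDedekindDomain Matrix Polynomial
open Literature.MeasureTheory.Group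
open Literature.NumberTheory.Automorphic Literature.NumberTheory.Automorphic.UnitaryGroup Literature.NumberTheory.Rogawski1990
open Summit.HodgeConjecture.HodgeConjecture.Cruxes.H413.F0P3cStCharTSWeylHypFibre
open Summit.HodgeConjecture.HodgeConjecture.Cruxes.H413.F0P3cStCharTSWeylHypTorsor
open Summit.HodgeConjecture.HodgeConjecture.Cruxes.H413.F0P3cStCharTSWeylHypCM
open Summit.HodgeConjecture.HodgeConjecture.Cruxes.H413.F0P3cStCharTSWeylHypMeasure
open Summit.HodgeConjecture.HodgeConjecture.Cruxes.H413.F0P3cStCharTSWeylHypWIF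
open Summit.HodgeConjecture.HodgeConjecture.Cruxes.H413.K2E3QuasiSplitTwoWeylRadial
open Summit.HodgeConjecture.HodgeConjecture.Cruxes.H413.K2E3QuasiSplitTwoTorusDefs
open Summit.HodgeConjecture.HodgeConjecture.Cruxes.H413
open scoped ENNReal NNReal MatrixGroups Pointwise

namespace Summit.HodgeConjecture.HodgeConjecture.Cruxes.H413.K2E3QuasiSplitTwoWeylKit

variable (L : Type) [Field L] [NumberField L] [IsCMField L] (v : HeightOneSpectrum (𝓞 ↥(maximalRealSubfield L)))

/-! ## §1 The hyperbolic set `Ω₂`: ★ D115's name IS the set of ★ W2-1; it is Borel; its torus trace is `T₂^{reg}` -/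

/-- **★ `hyperbolicSet₂ L v` IS the hyperbolic set `Ω` of ★ W2-1** (`IsConj t g ↔ ∃ c, c t c⁻¹ = g`; the `N = 3` twin is ★ `hyperbolicSet_eq_hypSet`).
[cite: Rogawski1990, §12.5 p. 182] -/
theorem hyperbolicSet₂_eq_hypSet : (hyperbolicSet₂ L v : Set ↥(unitaryGroupOfForm (conjLocal L (IsCMField.complexConj L) v) (cmLocalForm L 2 v))) = {x | ∃ g t : ↥(unitaryGroupOfForm (conjLocal L (IsCMField.complexConj L) v) (cmLocalForm L 2 v)), t ∈ (cmBorelTriple L 2 v).M ∧ IsRegularElt (t : GL (Fin 2) (LocalRing L v)) ∧ g * t * g⁻¹ = x} := by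
  ext x
  constructor
  · rintro ⟨t, hreg, hconj⟩
    obtain ⟨c, hc⟩ := isConj_iff.1 hconj
    exact ⟨c, t, t.2, hreg, hc⟩
  · rintro ⟨g, t, htT, hreg, h⟩
    exact ⟨⟨t, htT⟩, hreg, isConj_iff.2 ⟨g, h⟩⟩

/-- **The torus trace of `Ω₂` is `T₂^{reg}`**: `{t ∈ T₂ | ↑t ∈ Ω} = {t ∈ T₂ | t regular}` (★ (T1) `isRegularElt_of_mem_hypSet` ∕ `mem_hypSet_of_mem_torusU`).
[cite: Rogawski1990, §12.5 p. 182] -/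
theorem setOf_coe_mem_hypSet₂_eq :
    {t : ↥(cmBorelTriple L 2 v).M | (t : ↥(unitaryGroupOfForm (conjLocal L (IsCMField.complexConj L) v) (cmLocalForm L 2 v))) ∈ {x | ∃ g t : ↥(unitaryGroupOfForm (conjLocal L (IsCMField.complexConj L) v) (cmLocalForm L 2 v)), t ∈ (cmBorelTriple L 2 v).M ∧ IsRegularElt (t : GL (Fin 2) (LocalRing L v)) ∧ g * t * g⁻¹ = x}} = {t : ↥(cmBorelTriple L 2 v).M | IsRegularElt (((t : ↥(unitaryGroupOfForm (conjLocal L (IsCMField.complexConj L) v) (cmLocalForm L 2 v)))) : GL (Fin 2) (LocalRing L v))} := by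
  ext t
  exact ⟨fun h => isRegularElt_of_mem_hypSet (conjLocal L (IsCMField.complexConj L) v) (cmLocalForm L 2 v) h,
    fun h => mem_hypSet_of_mem_torusU (conjLocal L (IsCMField.complexConj L) v) (cmLocalForm L 2 v) t.2 h⟩

set_option maxHeartbeats 400000 in
/-- **`Ω₂` IS BOREL** (`v` non-split): it is the image of the Borel regular part `D₀ = {(q, t) | t ∈ T₂^{reg}}` of the Polish space `G₂ ⧸ T₂ × T₂` under the continuous
conjugation family, which is locally injective on `D₀` (★ `exists_isOpen_injOn_conjFamily` — `T₂` closed abelian, `Z(t) = T₂` on `T₂^{reg}` ★ (A1), `|N(T₂)∕T₂| = 2 ≠ 0` ★ JAC-LOC₂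
(B4)); Lusin–Souslin ★ `measurableSet_image_inter_of_locallyInjOn`.  (The block of ★ W2-1 §2 (§c–§d), exported.) [cite: Rogawski1990, §12.5 p. 182] [cite: HarishChandra1970, Lemma 42] -/
theorem measurableSet_hypSet₂ (hns : ∀ w : PlacesOver L v, IsCMField.complexConj L • w.1 = w.1) [MeasurableSpace ↥(unitaryGroupOfForm (conjLocal L (IsCMField.complexConj L) v) (cmLocalForm L 2 v))] [BorelSpace ↥(unitaryGroupOfForm (conjLocal L (IsCMField.complexConj L) v) (cmLocalForm L 2 v))] [LocallyCompactSpace ↥(unitaryGroupOfForm (conjLocal L (IsCMField.complexConj L) v) (cmLocalForm L 2 v))] [SecondCountableTopology ↥(unitaryGroupOfForm (conjLocal L (IsCMField.complexConj L) v) (cmLocalForm L 2 v))] [T2Space ↥(unitaryGroupOfForm (conjLocal L (IsCMField.complexConj L) v) (cmLocalForm L 2 v))] :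
    MeasurableSet {x | ∃ g t : ↥(unitaryGroupOfForm (conjLocal L (IsCMField.complexConj L) v) (cmLocalForm L 2 v)), t ∈ (cmBorelTriple L 2 v).M ∧ IsRegularElt (t : GL (Fin 2) (LocalRing L v)) ∧ g * t * g⁻¹ = x} := by
  classical
  letI : MeasurableSpace (↥(unitaryGroupOfForm (conjLocal L (IsCMField.complexConj L) v) (cmLocalForm L 2 v)) ⧸ (cmBorelTriple L 2 v).M) := borel _
  haveI : BorelSpace (↥(unitaryGroupOfForm (conjLocal L (IsCMField.complexConj L) v) (cmLocalForm L 2 v)) ⧸ (cmBorelTriple L 2 v).M) := ⟨rfl⟩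
  haveI : Nontrivial (LocalRing L v) := UnitaryGroup.nontrivial_localRing L v
  have hR : ∀ x : LocalRing L v, x ≠ 0 → IsUnit x := isUnit_of_ne_zero_of_nonsplit L v hns
  have hJ : cmLocalForm L 2 v = (StdForm.antidiagonal 2).over (LocalRing L v) := cmLocalForm_eq_over L 2 v
  have hex := exists_mem_torusU_isRegularElt_two_cm L v hns
  have hT := isClosed_cmBorelTriple_M_two L v
  have hTc : ∀ a ∈ (cmBorelTriple L 2 v).M, ∀ b ∈ (cmBorelTriple L 2 v).M, a * b = b * a :=
    F0P3cStCharTSUpTrU2Norm.forall_mem_torusU_mul_comm (conjLocal L (IsCMField.complexConj L) v)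
  have hW : (((cmBorelTriple L 2 v).M).subgroupOf (Subgroup.normalizer (((cmBorelTriple L 2 v).M : Subgroup ↥(unitaryGroupOfForm (conjLocal L (IsCMField.complexConj L) v) (cmLocalForm L 2 v))) : Set ↥(unitaryGroupOfForm (conjLocal L (IsCMField.complexConj L) v) (cmLocalForm L 2 v))))).index = 2 :=
    F0P3cStCharTSUpTrU2Norm.index_torusU_subgroupOf_normalizer_two_eq_two (conjLocal L (IsCMField.complexConj L) v) hR hJ hex
  have hW0 := ne_of_eq_of_ne hW two_ne_zero
  obtain ⟨Φ, hΦ⟩ := exists_conjFamily (cmBorelTriple L 2 v).M hTc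
  haveI : PolishSpace ((↥(unitaryGroupOfForm (conjLocal L (IsCMField.complexConj L) v) (cmLocalForm L 2 v)) ⧸ (cmBorelTriple L 2 v).M) × ↥(cmBorelTriple L 2 v).M) := polishSpace_quotient_prod_subgroup (cmBorelTriple L 2 v).M hT
  have hΦc : Continuous Φ := (continuous_conjFamily_and_smul (cmBorelTriple L 2 v).M Φ hΦ).1
  haveI : SecondCountableTopology ↥(cmBorelTriple L 2 v).M := TopologicalSpace.Subtype.secondCountableTopology _
  haveI : BorelSpace ((↥(unitaryGroupOfForm (conjLocal L (IsCMField.complexConj L) v) (cmLocalForm L 2 v)) ⧸ (cmBorelTriple L 2 v).M) × ↥(cmBorelTriple L 2 v).M) := Prod.borelSpace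
  have hD₀ : MeasurableSet {p : (↥(unitaryGroupOfForm (conjLocal L (IsCMField.complexConj L) v) (cmLocalForm L 2 v)) ⧸ (cmBorelTriple L 2 v).M) × ↥(cmBorelTriple L 2 v).M | IsRegularElt (((p.2 : ↥(unitaryGroupOfForm (conjLocal L (IsCMField.complexConj L) v) (cmLocalForm L 2 v)))) : GL (Fin 2) (LocalRing L v))} :=
    (isOpen_setOf_isRegularElt_torusU (conjLocal L (IsCMField.complexConj L) v) (cmLocalForm L 2 v) hR).measurableSet.preimage measurable_snd
  have hinj : ∀ z ∈ {p : (↥(unitaryGroupOfForm (conjLocal L (IsCMField.complexConj L) v) (cmLocalForm L 2 v)) ⧸ (cmBorelTriple L 2 v).M) × ↥(cmBorelTriple L 2 v).M | IsRegularElt (((p.2 : ↥(unitaryGroupOfForm (conjLocal L (IsCMField.complexConj L) v) (cmLocalForm L 2 v)))) : GL (Fin 2) (LocalRing L v))},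
      ∃ U : Set ((↥(unitaryGroupOfForm (conjLocal L (IsCMField.complexConj L) v) (cmLocalForm L 2 v)) ⧸ (cmBorelTriple L 2 v).M) × ↥(cmBorelTriple L 2 v).M), IsOpen U ∧ z ∈ U ∧
        InjOn Φ (U ∩ {p | IsRegularElt (((p.2 : ↥(unitaryGroupOfForm (conjLocal L (IsCMField.complexConj L) v) (cmLocalForm L 2 v)))) : GL (Fin 2) (LocalRing L v))}) := fun z _ =>
    exists_isOpen_injOn_conjFamily (cmBorelTriple L 2 v).M hT hTc Φ hΦ
      {x : ↥(unitaryGroupOfForm (conjLocal L (IsCMField.complexConj L) v) (cmLocalForm L 2 v)) | IsRegularElt (x : GL (Fin 2) (LocalRing L v))} (fun t ht => centralizer_eq_torusU_of_isRegularElt (conjLocal L (IsCMField.complexConj L) v) (cmLocalForm L 2 v) t.2 ht) hW0 z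
  have hΩeq : Φ '' {p : (↥(unitaryGroupOfForm (conjLocal L (IsCMField.complexConj L) v) (cmLocalForm L 2 v)) ⧸ (cmBorelTriple L 2 v).M) × ↥(cmBorelTriple L 2 v).M | IsRegularElt (((p.2 : ↥(unitaryGroupOfForm (conjLocal L (IsCMField.complexConj L) v) (cmLocalForm L 2 v)))) : GL (Fin 2) (LocalRing L v))} = {x | ∃ g t : ↥(unitaryGroupOfForm (conjLocal L (IsCMField.complexConj L) v) (cmLocalForm L 2 v)), t ∈ (cmBorelTriple L 2 v).M ∧ IsRegularElt (t : GL (Fin 2) (LocalRing L v)) ∧ g * t * g⁻¹ = x} := by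
    ext x
    constructor
    · rintro ⟨⟨q, t⟩, ht, rfl⟩
      obtain ⟨g, rfl⟩ := QuotientGroup.mk_surjective q
      exact ⟨g, t, t.2, ht, (hΦ g t).symm⟩
    · rintro ⟨g, t, htT, ht, rfl⟩
      exact ⟨(QuotientGroup.mk g, ⟨t, htT⟩), ht, hΦ g ⟨t, htT⟩⟩
  rw [← hΩeq, ← Set.univ_inter {p : (↥(unitaryGroupOfForm (conjLocal L (IsCMField.complexConj L) v) (cmLocalForm L 2 v)) ⧸ (cmBorelTriple L 2 v).M) × ↥(cmBorelTriple L 2 v).M | IsRegularElt (((p.2 : ↥(unitaryGroupOfForm (conjLocal L (IsCMField.complexConj L) v) (cmLocalForm L 2 v)))) : GL (Fin 2) (LocalRing L v))}]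
  exact measurableSet_image_inter_of_locallyInjOn hD₀ hΦc hinj MeasurableSet.univ

/-- **`hyperbolicSet₂ L v` is Borel** (`v` non-split; §1 `measurableSet_hypSet₂` through `hyperbolicSet₂_eq_hypSet`). [cite: Rogawski1990, §12.5 p. 182] -/
theorem measurableSet_hyperbolicSet₂ (hns : ∀ w : PlacesOver L v, IsCMField.complexConj L • w.1 = w.1) [MeasurableSpace ↥(unitaryGroupOfForm (conjLocal L (IsCMField.complexConj L) v) (cmLocalForm L 2 v))] [BorelSpace ↥(unitaryGroupOfForm (conjLocal L (IsCMField.complexConj L) v) (cmLocalForm L 2 v))] [LocallyCompactSpace ↥(unitaryGroupOfForm (conjLocal L (IsCMField.complexConj L) v) (cmLocalForm L 2 v))] [SecondCountableTopology ↥(unitaryGroupOfForm (conjLocal L (IsCMField.complexConj L) v) (cmLocalForm L 2 v))] [T2Space ↥(unitaryGroupOfForm (conjLocal L (IsCMField.complexConj L) v) (cmLocalForm L 2 v))] :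
    MeasurableSet (hyperbolicSet₂ L v : Set ↥(unitaryGroupOfForm (conjLocal L (IsCMField.complexConj L) v) (cmLocalForm L 2 v))) := by
  rw [hyperbolicSet₂_eq_hypSet]; exact measurableSet_hypSet₂ L v hns

/-! ## §2 The diagonal torus `T₂`: compact core, a.e. regularity, the normalised Haar measure -/

/-- **The compact core of `T₂` is compact and open** (`v` non-split): `T₂ = Z(t₀)` for a regular `t₀ ∈ T₂` (★ W2-1 `exists_mem_torusU_isRegularElt_two_cm`, ★ (A1)) and ★
`compactCore_centralizer_local_facts_of_isRegularElt` at `N = 2`.  (`N = 3` twin: ★ `isCompact_isOpen_compactCore_cmTorus`.) [cite: Rogawski1990, §4.3 (4.3.1) p. 43] -/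
theorem isCompact_isOpen_compactCore_cmTorus₂ (hns : ∀ w : PlacesOver L v, IsCMField.complexConj L • w.1 = w.1) :
    IsCompact (compactCore ↥(cmBorelTriple L 2 v).M) ∧ IsOpen (compactCore ↥(cmBorelTriple L 2 v).M) := by
  obtain ⟨t₀, ht₀, hreg₀⟩ := exists_mem_torusU_isRegularElt_two_cm L v hns
  have hZ : Subgroup.centralizer ({t₀} : Set ↥(unitaryGroupOfForm (conjLocal L (IsCMField.complexConj L) v) (cmLocalForm L 2 v))) = (cmBorelTriple L 2 v).M := centralizer_eq_torusU_of_isRegularElt (conjLocal L (IsCMField.complexConj L) v) (cmLocalForm L 2 v) ht₀ hreg₀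
  have h : (∀ a b : ↥(Subgroup.centralizer ({t₀} : Set ↥(unitaryGroupOfForm (conjLocal L (IsCMField.complexConj L) v) (cmLocalForm L 2 v)))), a * b = b * a) ∧
      IsCompact (compactCore ↥(Subgroup.centralizer ({t₀} : Set ↥(unitaryGroupOfForm (conjLocal L (IsCMField.complexConj L) v) (cmLocalForm L 2 v))))) ∧ IsOpen (compactCore ↥(Subgroup.centralizer ({t₀} : Set ↥(unitaryGroupOfForm (conjLocal L (IsCMField.complexConj L) v) (cmLocalForm L 2 v))))) :=
    compactCore_centralizer_local_facts_of_isRegularElt (IsCMField.complexConj L) 2 (Matrix.of fun i j : Fin 2 => if i.val + j.val + 1 = 2 then (1 : L) else 0) (IsCMField.complexConj_ne_one L)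
      (antidiagOne_map_transpose (IsCMField.complexConj L) 2) (isUnit_antidiagOne_det L 2) t₀ hreg₀
  rw [hZ] at h
  exact h.2

/-- **`tT`-almost every element of `T₂` is regular** (every Haar measure `tT` on `T₂`, every finite `v`): ★ `ae_isUnit_torusEntry_sub_two` gives the unit differences
`d₀ − d₁`, `d₁ − d₀` a.e., and ★ `isRegularElt_glDiagonal_of_isUnit_sub` turns them into regularity.  (`N = 3` twin: ★ `ae_isRegularElt_cmTorus`.)
[cite: Rogawski1990, §12.5 p. 183] [cite: HarishChandra1970, Lemma 42] -/
theorem ae_isRegularElt_cmTorus₂ [MeasurableSpace ↥(unitaryGroupOfForm (conjLocal L (IsCMField.complexConj L) v) (cmLocalForm L 2 v))] [BorelSpace ↥(unitaryGroupOfForm (conjLocal L (IsCMField.complexConj L) v) (cmLocalForm L 2 v))] (μT : Measure ↥(cmBorelTriple L 2 v).M) [μT.IsHaarMeasure] :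
    ∀ᵐ t : ↥(cmBorelTriple L 2 v).M ∂μT, IsRegularElt (((t : ↥(unitaryGroupOfForm (conjLocal L (IsCMField.complexConj L) v) (cmLocalForm L 2 v)))) : GL (Fin 2) (LocalRing L v)) := by
  filter_upwards [ae_isUnit_torusEntry_sub_two L v μT] with t ht
  obtain ⟨d, hd⟩ := (mem_torusU_iff _).1 t.2
  have hdi : ∀ i, torusEntry (conjLocal L (IsCMField.complexConj L) v) (cmLocalForm L 2 v) i t = d i := fun i =>
    torusEntry_eq_of_glDiagonal_eq _ _ i t d hd
  rw [← hd]
  refine isRegularElt_glDiagonal_of_isUnit_sub fun i j hij => ?_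
  rw [← hdi, ← hdi]
  fin_cases i <;> fin_cases j
  · exact absurd rfl hij
  · exact ht.1
  · exact ht.2.1
  · exact absurd rfl hij

/-- **`T₂` carries a Haar measure, inversion invariant, with mass `1` on its compact core** (`v` non-split): `T₂ = Z(t₀)` for a regular `t₀ ∈ T₂` and ★
`forall_isRegularElt_exists_isHaarMeasure_compactCore_centralizer_local_eq_one` at `N = 2` provides the measure on `Z(t₀)`.  (`N = 3` twin: ★ `exists_haar_cmTorus_compactCore_eq_one`.)
[cite: Rogawski1990, §4.3 (4.3.1) p. 43; §1.7 p. 6] -/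
theorem exists_haar_cmTorus_compactCore_eq_one₂ (hns : ∀ w : PlacesOver L v, IsCMField.complexConj L • w.1 = w.1) [MeasurableSpace ↥(unitaryGroupOfForm (conjLocal L (IsCMField.complexConj L) v) (cmLocalForm L 2 v))] [BorelSpace ↥(unitaryGroupOfForm (conjLocal L (IsCMField.complexConj L) v) (cmLocalForm L 2 v))] :
    ∃ tT : Measure ↥(cmBorelTriple L 2 v).M, tT.IsHaarMeasure ∧ tT.IsInvInvariant ∧ tT (compactCore ↥(cmBorelTriple L 2 v).M) = 1 := by
  obtain ⟨t₀, ht₀, hreg₀⟩ := exists_mem_torusU_isRegularElt_two_cm L v hns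
  have hZ : Subgroup.centralizer ({t₀} : Set ↥(unitaryGroupOfForm (conjLocal L (IsCMField.complexConj L) v) (cmLocalForm L 2 v))) = (cmBorelTriple L 2 v).M := centralizer_eq_torusU_of_isRegularElt (conjLocal L (IsCMField.complexConj L) v) (cmLocalForm L 2 v) ht₀ hreg₀
  -- the `«local»` carrier IS this one: hand it the σ-algebra
  letI : MeasurableSpace ↥(«local» L (IsCMField.complexConj L) 2 (Matrix.of fun i j : Fin 2 => if i.val + j.val + 1 = 2 then (1 : L) else 0) v) := ‹MeasurableSpace ↥(unitaryGroupOfForm (conjLocal L (IsCMField.complexConj L) v) (cmLocalForm L 2 v))›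
  haveI : BorelSpace ↥(«local» L (IsCMField.complexConj L) 2 (Matrix.of fun i j : Fin 2 => if i.val + j.val + 1 = 2 then (1 : L) else 0) v) := ‹BorelSpace ↥(unitaryGroupOfForm (conjLocal L (IsCMField.complexConj L) v) (cmLocalForm L 2 v))›
  have h : ∃ tZ : Measure ↥(Subgroup.centralizer ({t₀} : Set ↥(unitaryGroupOfForm (conjLocal L (IsCMField.complexConj L) v) (cmLocalForm L 2 v)))),
      tZ.IsHaarMeasure ∧ tZ.IsInvInvariant ∧ tZ (compactCore ↥(Subgroup.centralizer ({t₀} : Set ↥(unitaryGroupOfForm (conjLocal L (IsCMField.complexConj L) v) (cmLocalForm L 2 v))))) = 1 :=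
    forall_isRegularElt_exists_isHaarMeasure_compactCore_centralizer_local_eq_one (IsCMField.complexConj L) 2
      (Matrix.of fun i j : Fin 2 => if i.val + j.val + 1 = 2 then (1 : L) else 0) (IsCMField.complexConj_ne_one L) (antidiagOne_map_transpose (IsCMField.complexConj L) 2)
      (isUnit_antidiagOne_det L 2) t₀ hreg₀
  rw [hZ] at h
  exact h

/-! ## §3 Haar transport and change of variables along the chart `ι₂ : (LocalRing L v)ˣ ≃ₜ* T₂` -/

section Haar

variable [MeasurableSpace (LocalRing L v)ˣ] [BorelSpace (LocalRing L v)ˣ] [MeasurableSpace ↥(unitaryGroupOfForm (conjLocal L (IsCMField.complexConj L) v) (cmLocalForm L 2 v))] [BorelSpace ↥(unitaryGroupOfForm (conjLocal L (IsCMField.complexConj L) v) (cmLocalForm L 2 v))]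

/-- **`ι₂` is a measurable embedding** (a homeomorphism onto `T₂`). [cite: Rogawski1990, §12.2 p. 173] -/
theorem measurableEmbedding_torusChart₂ : MeasurableEmbedding (torusChart₂ L v) := by
  rw [← coe_torusChartEquiv₂]; exact (torusChartEquiv₂ L v).toHomeomorph.measurableEmbedding

/-- **`ι₂_* μM` is a Haar measure on `T₂`** for every Haar measure `μM` on `(LocalRing L v)ˣ` (Mathlib `ContinuousMulEquiv.isHaarMeasure_map`).  (`N = 3` twin: ★
`isHaarMeasure_map_torusChart`.) [cite: Rogawski1990, §12.2 p. 173] -/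
theorem isHaarMeasure_map_torusChart₂ (μM : Measure (LocalRing L v)ˣ) [μM.IsHaarMeasure] : (μM.map (torusChart₂ L v)).IsHaarMeasure := by
  rw [← coe_torusChartEquiv₂]
  exact ContinuousMulEquiv.isHaarMeasure_map μM (torusChartEquiv₂ L v)

/-- **`ι₂_* μM` is inversion invariant** when `μM` is (`ι₂` is a group isomorphism; ★ `isInvInvariant_map_mulEquiv`). [cite: Rogawski1990, §12.2 p. 173] -/
theorem isInvInvariant_map_torusChart₂ (μM : Measure (LocalRing L v)ˣ) [μM.IsInvInvariant] : (μM.map (torusChart₂ L v)).IsInvInvariant := by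
  rw [← coe_torusChartEquiv₂]
  exact isInvInvariant_map_mulEquiv (torusChartEquiv₂ L v).toMulEquiv (torusChartEquiv₂ L v).continuous.measurable μM

/-- **Change of variables along the chart, Bochner form**: `∫_{T₂} f d(ι₂_* μM) = ∫ f ∘ ι₂ dμM` (no measurability of `f` needed).  (`N = 3` twin: ★ `integral_comp_torusChart`.)
[cite: Rogawski1990, §12.7 L. 12.7.2 (proof) p. 193] -/
theorem integral_comp_torusChart₂ (μM : Measure (LocalRing L v)ˣ) (f : ↥(cmBorelTriple L 2 v).M → ℂ) :
    ∫ t, f t ∂(μM.map (torusChart₂ L v)) = ∫ m, f (torusChart₂ L v m) ∂μM :=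
  (measurableEmbedding_torusChart₂ L v).integral_map f

/-- **Change of variables along the chart, `∫⁻` form**: `∫⁻_{T₂} f d(ι₂_* μM) = ∫⁻ f ∘ ι₂ dμM`. [cite: Rogawski1990, §12.7 L. 12.7.2 (proof) p. 193] -/
theorem lintegral_comp_torusChart₂ (μM : Measure (LocalRing L v)ˣ) (f : ↥(cmBorelTriple L 2 v).M → ℝ≥0∞) :
    ∫⁻ t, f t ∂(μM.map (torusChart₂ L v)) = ∫⁻ m, f (torusChart₂ L v m) ∂μM :=
  (measurableEmbedding_torusChart₂ L v).lintegral_map f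

/-- **The calibration constant through the chart**: `(ι₂_* μM)(T₂ᶜ) = μM(ι₂⁻¹ T₂ᶜ)`. [cite: Rogawski1990, §12.7 L. 12.7.2 (proof) p. 193] -/
theorem map_torusChart₂_apply_compactCore (hns : ∀ w : PlacesOver L v, IsCMField.complexConj L • w.1 = w.1) (μM : Measure (LocalRing L v)ˣ) :
    (μM.map (torusChart₂ L v)) (compactCore ↥(cmBorelTriple L 2 v).M) = μM ((torusChart₂ L v) ⁻¹' compactCore ↥(cmBorelTriple L 2 v).M) :=
  Measure.map_apply (continuous_torusChart₂ L v).measurable (isCompact_isOpen_compactCore_cmTorus₂ L v hns).1.isClosed.measurableSet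

end Haar

/-! ## §4 Canonical orbital integrals at a regular `t ∈ T₂` as fibre integrals of the conjugation family -/

set_option maxHeartbeats 800000 in
-- instance-term unification at the CM carrier (`quotientMeasure` ∕ canonical family), as in the ★ `N = 3` original
/-- **CANONICAL ORBITAL INTEGRAL AT A REGULAR `t ∈ T₂` = FIBRE INTEGRAL OF THE CONJUGATION FAMILY** (every finite `v`): for `mQv` canonical for the regular classes (★
`IsCanonical`), `tT` THE Haar measure of `T₂` with `tT(T₂ᶜ) = 1` (inversion invariant), `t ∈ T₂^{reg}` and `φ` measurable:
**`classOrbitalIntegral mQv φ ⟦t⟧ = ∫_{G₂ ⧸ T₂} φ(Φ(q, t)) d(ν∕tT)(q)`** — ★ `IsCanonical.classOrbitalIntegral_mk_eq_orbitalIntegral'` with the canonical torus measure of `Z(t)` (★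
exists at `N = 2`), which read on `T₂ = Z(t)` (★ (A1)) IS `tT` (★ `eq_of_apply_compactCore_eq_one`, ★ `image_compactCore`), then ★ WIF §1.  The `N = 2` port, token for token, of ★
`classOrbitalIntegral_mk_eq_integral_conjFamily`. [cite: Rogawski1990, §4.3 (4.3.1) p. 43; §4.9 p. 54; §12.5 p. 182] [cite: DeitmarEchterhoff2014, Thm. 1.5.3] -/
theorem classOrbitalIntegral_mk_eq_integral_conjFamily₂
    [MeasurableSpace ↥(unitaryGroupOfForm (conjLocal L (IsCMField.complexConj L) v) (cmLocalForm L 2 v))] [BorelSpace ↥(unitaryGroupOfForm (conjLocal L (IsCMField.complexConj L) v) (cmLocalForm L 2 v))] [LocallyCompactSpace ↥(unitaryGroupOfForm (conjLocal L (IsCMField.complexConj L) v) (cmLocalForm L 2 v))] [SecondCountableTopology ↥(unitaryGroupOfForm (conjLocal L (IsCMField.complexConj L) v) (cmLocalForm L 2 v))] [T2Space ↥(unitaryGroupOfForm (conjLocal L (IsCMField.complexConj L) v) (cmLocalForm L 2 v))]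
    [∀ γ : ↥(unitaryGroupOfForm (conjLocal L (IsCMField.complexConj L) v) (cmLocalForm L 2 v)), MeasurableSpace (↥(unitaryGroupOfForm (conjLocal L (IsCMField.complexConj L) v) (cmLocalForm L 2 v)) ⧸ Subgroup.centralizer ({γ} : Set ↥(unitaryGroupOfForm (conjLocal L (IsCMField.complexConj L) v) (cmLocalForm L 2 v))))] [∀ γ : ↥(unitaryGroupOfForm (conjLocal L (IsCMField.complexConj L) v) (cmLocalForm L 2 v)), BorelSpace (↥(unitaryGroupOfForm (conjLocal L (IsCMField.complexConj L) v) (cmLocalForm L 2 v)) ⧸ Subgroup.centralizer ({γ} : Set ↥(unitaryGroupOfForm (conjLocal L (IsCMField.complexConj L) v) (cmLocalForm L 2 v))))]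
    [MeasurableSpace (↥(unitaryGroupOfForm (conjLocal L (IsCMField.complexConj L) v) (cmLocalForm L 2 v)) ⧸ (cmBorelTriple L 2 v).M)] [BorelSpace (↥(unitaryGroupOfForm (conjLocal L (IsCMField.complexConj L) v) (cmLocalForm L 2 v)) ⧸ (cmBorelTriple L 2 v).M)]
    (ν : Measure ↥(unitaryGroupOfForm (conjLocal L (IsCMField.complexConj L) v) (cmLocalForm L 2 v))) [ν.IsHaarMeasure] [ν.IsMulRightInvariant]
    {mQv : OrbitalMeasureFamily ↥(unitaryGroupOfForm (conjLocal L (IsCMField.complexConj L) v) (cmLocalForm L 2 v))} (hcanQ : mQv.IsCanonical (fun γ => IsRegularElt (γ.val : GL (Fin 2) (LocalRing L v))) ν)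
    (tT : Measure ↥(cmBorelTriple L 2 v).M) [tT.IsHaarMeasure] [tT.IsInvInvariant] (htT : tT (compactCore ↥(cmBorelTriple L 2 v).M) = 1)
    (Φ : (↥(unitaryGroupOfForm (conjLocal L (IsCMField.complexConj L) v) (cmLocalForm L 2 v)) ⧸ (cmBorelTriple L 2 v).M) × ↥(cmBorelTriple L 2 v).M → ↥(unitaryGroupOfForm (conjLocal L (IsCMField.complexConj L) v) (cmLocalForm L 2 v))) (hΦ : ∀ (x : ↥(unitaryGroupOfForm (conjLocal L (IsCMField.complexConj L) v) (cmLocalForm L 2 v))) (t : ↥(cmBorelTriple L 2 v).M), Φ (QuotientGroup.mk x, t) = x * t * x⁻¹)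
    (t : ↥(cmBorelTriple L 2 v).M) (ht : IsRegularElt (((t : ↥(unitaryGroupOfForm (conjLocal L (IsCMField.complexConj L) v) (cmLocalForm L 2 v)))) : GL (Fin 2) (LocalRing L v))) (φ : ↥(unitaryGroupOfForm (conjLocal L (IsCMField.complexConj L) v) (cmLocalForm L 2 v)) → ℂ) (hφ : Measurable φ) :
    classOrbitalIntegral mQv φ (ConjClasses.mk (t : ↥(unitaryGroupOfForm (conjLocal L (IsCMField.complexConj L) v) (cmLocalForm L 2 v)))) = ∫ q, φ (Φ (q, t)) ∂(quotientMeasure (cmBorelTriple L 2 v).M tT (isClosed_cmBorelTriple_M_two L v) ν) := by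
  have hZeq : Subgroup.centralizer ({(t : ↥(unitaryGroupOfForm (conjLocal L (IsCMField.complexConj L) v) (cmLocalForm L 2 v)))} : Set ↥(unitaryGroupOfForm (conjLocal L (IsCMField.complexConj L) v) (cmLocalForm L 2 v))) = (cmBorelTriple L 2 v).M := centralizer_eq_torusU_of_isRegularElt (conjLocal L (IsCMField.complexConj L) v) (cmLocalForm L 2 v) t.2 ht
  have hZ : ∀ g : ↥(unitaryGroupOfForm (conjLocal L (IsCMField.complexConj L) v) (cmLocalForm L 2 v)), (MulEquiv.refl ↥(unitaryGroupOfForm (conjLocal L (IsCMField.complexConj L) v) (cmLocalForm L 2 v))) g ∈ (cmBorelTriple L 2 v).M ↔ g ∈ Subgroup.centralizer ({(t : ↥(unitaryGroupOfForm (conjLocal L (IsCMField.complexConj L) v) (cmLocalForm L 2 v)))} : Set ↥(unitaryGroupOfForm (conjLocal L (IsCMField.complexConj L) v) (cmLocalForm L 2 v))) := fun g => by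
    rw [MulEquiv.refl_apply, hZeq]
  letI : MeasurableSpace ↥(«local» L (IsCMField.complexConj L) 2 (Matrix.of fun i j : Fin 2 => if i.val + j.val + 1 = 2 then (1 : L) else 0) v) := ‹MeasurableSpace ↥(unitaryGroupOfForm (conjLocal L (IsCMField.complexConj L) v) (cmLocalForm L 2 v))›
  haveI : BorelSpace ↥(«local» L (IsCMField.complexConj L) 2 (Matrix.of fun i j : Fin 2 => if i.val + j.val + 1 = 2 then (1 : L) else 0) v) := ‹BorelSpace ↥(unitaryGroupOfForm (conjLocal L (IsCMField.complexConj L) v) (cmLocalForm L 2 v))›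
  have hexZ : ∃ tZ : Measure ↥(Subgroup.centralizer ({(t : ↥(unitaryGroupOfForm (conjLocal L (IsCMField.complexConj L) v) (cmLocalForm L 2 v)))} : Set ↥(unitaryGroupOfForm (conjLocal L (IsCMField.complexConj L) v) (cmLocalForm L 2 v)))),
      tZ.IsHaarMeasure ∧ tZ.IsInvInvariant ∧ tZ (compactCore ↥(Subgroup.centralizer ({(t : ↥(unitaryGroupOfForm (conjLocal L (IsCMField.complexConj L) v) (cmLocalForm L 2 v)))} : Set ↥(unitaryGroupOfForm (conjLocal L (IsCMField.complexConj L) v) (cmLocalForm L 2 v))))) = 1 :=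
    forall_isRegularElt_exists_isHaarMeasure_compactCore_centralizer_local_eq_one (IsCMField.complexConj L) 2
      (Matrix.of fun i j : Fin 2 => if i.val + j.val + 1 = 2 then (1 : L) else 0) (IsCMField.complexConj_ne_one L) (antidiagOne_map_transpose (IsCMField.complexConj L) 2)
      (isUnit_antidiagOne_det L 2) (t : ↥(unitaryGroupOfForm (conjLocal L (IsCMField.complexConj L) v) (cmLocalForm L 2 v))) ht
  obtain ⟨tZ, hZhaar, hZinv, hZone⟩ := hexZ
  haveI := hZhaar
  haveI := hZinv
  -- `tT` is `tZ` read on `T₂`: both are Haar measures on `T₂` with mass one on the compact core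
  set e := subgroupCongrHomeomorph (MulEquiv.refl ↥(unitaryGroupOfForm (conjLocal L (IsCMField.complexConj L) v) (cmLocalForm L 2 v))) (Subgroup.centralizer ({(t : ↥(unitaryGroupOfForm (conjLocal L (IsCMField.complexConj L) v) (cmLocalForm L 2 v)))} : Set ↥(unitaryGroupOfForm (conjLocal L (IsCMField.complexConj L) v) (cmLocalForm L 2 v)))) (cmBorelTriple L 2 v).M hZ continuous_id continuous_id with he
  obtain ⟨e', hee'⟩ : ∃ e' : ↥(Subgroup.centralizer ({(t : ↥(unitaryGroupOfForm (conjLocal L (IsCMField.complexConj L) v) (cmLocalForm L 2 v)))} : Set ↥(unitaryGroupOfForm (conjLocal L (IsCMField.complexConj L) v) (cmLocalForm L 2 v)))) ≃ₜ* ↥(cmBorelTriple L 2 v).M, (⇑e : ↥(Subgroup.centralizer ({(t : ↥(unitaryGroupOfForm (conjLocal L (IsCMField.complexConj L) v) (cmLocalForm L 2 v)))} : Set ↥(unitaryGroupOfForm (conjLocal L (IsCMField.complexConj L) v) (cmLocalForm L 2 v)))) → ↥(cmBorelTriple L 2 v).M) = ⇑e' :=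
    ⟨{ MulEquiv.subgroupCongr hZeq with continuous_toFun := e.continuous, continuous_invFun := e.symm.continuous }, rfl⟩
  haveI : LocallyCompactSpace ↥(cmBorelTriple L 2 v).M := (isClosed_cmBorelTriple_M_two L v).isClosedEmbedding_subtypeVal.locallyCompactSpace
  haveI : SecondCountableTopology ↥(cmBorelTriple L 2 v).M := TopologicalSpace.Subtype.secondCountableTopology _
  haveI : (Measure.map e tZ).IsHaarMeasure := by rw [hee']; exact ContinuousMulEquiv.isHaarMeasure_map tZ e'
  have htZ : tT = Measure.map e tZ := by
    refine eq_of_apply_compactCore_eq_one tT _ htT ?_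
    have hme : MeasurableEmbedding (⇑e') := e'.toHomeomorph.measurableEmbedding
    rw [hee', ← image_compactCore e', hme.map_apply]
    change tZ (e' ⁻¹' (e' '' compactCore ↥(Subgroup.centralizer ({(t : ↥(unitaryGroupOfForm (conjLocal L (IsCMField.complexConj L) v) (cmLocalForm L 2 v)))} : Set ↥(unitaryGroupOfForm (conjLocal L (IsCMField.complexConj L) v) (cmLocalForm L 2 v)))))) = 1
    rwa [e'.injective.preimage_image]
  have hconj : ∀ g x : ↥(unitaryGroupOfForm (conjLocal L (IsCMField.complexConj L) v) (cmLocalForm L 2 v)), IsRegularElt (g : GL (Fin 2) (LocalRing L v)) → IsRegularElt ((x * g * x⁻¹ : ↥(unitaryGroupOfForm (conjLocal L (IsCMField.complexConj L) v) (cmLocalForm L 2 v))) : GL (Fin 2) (LocalRing L v)) :=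
    fun g x hg => (isRegularElt_coe_conj_iff (conjLocal L (IsCMField.complexConj L) v) (cmLocalForm L 2 v) x g).2 hg
  have hco := hcanQ.classOrbitalIntegral_mk_eq_orbitalIntegral' hconj ht tZ hZone φ
  rw [hco]
  exact orbitalIntegral_eq_integral_conjFamily_of_centralizer_eq (cmBorelTriple L 2 v).M (isClosed_cmBorelTriple_M_two L v) ν tT Φ hΦ t hZ tZ htZ φ hφ

end Summit.HodgeConjecture.HodgeConjecture.Cruxes.H413.K2E3QuasiSplitTwoWeylKit

end
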